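/-
Copyright (c) 2026 the pub-hodgecm-mathlib formalisation cell (harness21).  Prover seat hodgecm-mathlib-LH4-p08 (g9), req620 Track A «(D-RAM) FOUR-FRAME» squad, helper lane
on h413 = stmt-HodgeConjecture-24833 (count-neutral).  STAGE-1b, row (2), RamM lane of the (LAW) END — (R2) EDITION 2 (both parity regimes), after (R5a)∕(R5b).  2026-09-04.
-/
import Summits.HodgeConjecture.HodgeConjecture.Theorems.F0P3cDyRamToricCensusSumRamMWeld           -- ★ (LH4-p04 (g5)): the unit weld (letters); brings ★ Reindex `levelSet_eq_empty_of_succ_le_ramified`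
import Summits.HodgeConjecture.HodgeConjecture.Theorems.F0P3cDyRamToricCensusSumRamMV2CutOffset    -- ★ p860733 (this seat): (R5a) `toricCensusSum_ramM_v2_cut_offset`
import Summits.HodgeConjecture.HodgeConjecture.Theorems.F0P3cDyRamToricCensusSumRamMFlipV2         -- (this seat): (R5b) `toricCensusSum_ramM_flip_v2_cut_offset`
import HarnessLib

/-!
# Crux `H413`, line LH4 «(D-RAM) FOUR-FRAME» — STAGE-1b, row (2): (T5-P-weldΔ)-RamM **EDITION 2** «THE LEVEL-PIECE CUT WELD, TYPE RamM, modulo the per-cell facts — BOTH REGIMES»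

Cell `hodgecm-mathlib` (D-0151), FLOOR 0, crux item H413 = `stmt-HodgeConjecture-24833`, route of record `HCCMUnconditional`; squad F0∕P3c∕LH4 (req618∕req620); helper lane
`--supports stmt-HodgeConjecture-24833 --as helper` (count-neutral).  THEOREMS ONLY (no `def`, no instance, no notation, no `sorry`; default heartbeats).

★ p860627 (this seat) typed the cut weld in both parity CLASSES over the EDITION-1 cut identities, whose token letter `hpar` is strict: on the regime-B population
(`jl + 1 = m + s0`, realised near `1` — ★ (C) `orderCountCensusC` :295) the scaled token `m₁` has the other parity and ★ p860627 has no theorem.  With the EDITION-2 cut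
identities ★ p860733 `toricCensusSum_ramM_v2_cut_offset` ∕ `toricCensusSum_ramM_flip_v2_cut_offset` (this seat, (R5a)∕(R5b): `hparW` = «parity OR window»; near top cells
only AGREE) the same interface covers both regimes, and the proof is simpler (the tables are the census itself — ★ `toricCensusSum_ramM_weld`'s assembly, adapted-from
LH4-p04 (g5)):
* **`toricCensusSum_ramM_weld_cut_v2`** (standard class, `a′` even) and **`toricCensusSum_ramM_weld_cut_flip_v2`** (flipped class, `a′` odd): ★ p860627's binders with
  `hpar` ↦ `hparW`; conclusions VERBATIM.  These SUPERSEDE ★ p860627's heads for the socket (which stay true and ★).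
HONEST LABEL.  Count-neutral; abstract frame and multiplier, per-cell facts are HYPOTHESES ((R1)'s to discharge); no CM place, no law asserted; `HC_CM` is proved only modulo
the 7 printed citations (2 remaining named inputs: hLiu418 = `stmt-HodgeConjecture-24832`, h413 = `stmt-HodgeConjecture-24833`) until rung 0 closes.

## References
* [Kottwitz1986BaseChangeUnits] R. E. Kottwitz, *Base change for unit elements of Hecke algebras*, Compositio Math. 60 (1986): §1 pp. 240–241.
* [Rogawski1990] J. D. Rogawski, *Automorphic Representations of Unitary Groups in Three Variables*, Ann. of Math. Stud. 123 (1990): §4.9 Prop. 4.9.1 (b) p. 55, Lemma 4.9.3 p. 56.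
* [Flicker1998UnitaryFL] Y. Z. Flicker, *Elementary proof of the fundamental lemma for a unitary group*, Canad. J. Math. 50 (1998): Prop. 7 p. 84.
* [Jacobowitz1962] R. Jacobowitz, *Hermitian forms over local fields*, Amer. J. Math. 84 (1962): §4.
-/

set_option autoImplicit false

open WithZero IsLocalRing Finset
open scoped Valued Classical

namespace Summit.HodgeConjecture.HodgeConjecture.Cruxes.H413.F0P3cDyRamToricCensusSumRamMWeldCutV2

open Literature.NumberTheory.Automorphic.UnitaryThreeFourFrame (IsRamifiedQuadraticDatum)
open Summit.HodgeConjecture.HodgeConjecture.Cruxes.H413.F0P3cDyRamToricCensusDefs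
open Summit.HodgeConjecture.HodgeConjecture.Cruxes.H413.F0P3cDyRamToricLevelCensusRamM (levelSet_eq_empty_of_succ_le_ramified)
open Summit.HodgeConjecture.HodgeConjecture.Cruxes.H413.F0P3cDyRamToricCensusSumRamMV2CutOffset (toricCensusSum_ramM_v2_cut_offset)
open Summit.HodgeConjecture.HodgeConjecture.Cruxes.H413.F0P3cDyRamToricCensusSumRamMFlipV2 (toricCensusSum_ramM_flip_v2_cut_offset)

variable {K : Type} [Field K] [Valued K ℤᵐ⁰] {ρ Θ : K →+* K} {α ϖE h h' : K} {dρ t : ℕ}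

/-! ## §1 Standard parity class, EDITION 2 -/

/-- **(T5-P-weldΔ)-RamM EDITION 2, STANDARD CLASS — THE CUT WELD modulo the per-cell facts, BOTH PARITY REGIMES.**  ★ p860627 `toricCensusSum_ramM_weld_cut`'s binders
VERBATIM with the token letter relaxed to `hparW : m % 2 = (g + s0) % 2 ∨ jl + 2 ≤ m + 2g + s0` (the regime-B rows `jl + 1 = m + s0` lie in the window); same conclusion.
Proof = ★ `toricCensusSum_ramM_weld`'s table assembly on the census itself (no re-tabling: EDITION-2 binders ask the near top cells only to agree) + ★ p860733
`toricCensusSum_ramM_v2_cut_offset`.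
[cite: Kottwitz1986BaseChangeUnits, §1 pp. 240–241] [cite: Rogawski1990, §4.9 Prop. 4.9.1 (b) p. 55, Lemma 4.9.3 p. 56] [cite: Flicker1998UnitaryFL, Prop. 7 p. 84] [cite: Jacobowitz1962, §4] -/
theorem toricCensusSum_ramM_weld_cut_v2 (hD : IsRamifiedQuadraticDatum ρ α dρ t) (hvΘ : ∀ x, Valued.v (Θ x) = Valued.v x)
    (hρϖ : ρ ϖE = ϖE) (hϖE : Valued.v ϖE = exp (-2 : ℤ)) (hh : h ≠ 0) (hh' : h' ≠ 0)
    (q : ℕ) {g s0 jl m : ℕ} (ε : ℚ) (hq : 2 ≤ q) (hg : 1 ≤ g) (hs0 : 1 ≤ s0) (hjl : jl % 2 = g % 2)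
    (hjlS : 3 * g + 2 * s0 ≤ jl + 2 + 2 * ((g + s0) % 2)) (hparW : m % 2 = (g + s0) % 2 ∨ jl + 2 ≤ m + 2 * g + s0)
    (hmS : g + s0 - (g + s0) % 2 ≤ m + 1) (hm : m ≤ jl) (hε : ε = 1 ∨ (ε = -1 ∧ jl + 2 ≤ m + 2 * g + s0)) {μ : K}
    (hC1P : ∀ j a, (levelSet ρ Θ α ϖE h j a).ncard = (if j = 0 then (if a = 0 then 1 else 0) else if j < a then 0
      else if j - a + 1 = s0 then q ^ j else if j - a + 1 < s0 then (if a = 0 then q ^ j else 0) else if (j - a - s0) % 2 = 1 then 0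
      else if a = 0 then (if 2 * g ≤ j - a - s0 then 2 else 1) * q ^ (j - (j - a - s0) / 2)
      else if j - a - s0 + 2 < 2 * g then (q - 1) * q ^ (j - 1 - (j - a - s0) / 2) else if j - a - s0 + 2 = 2 * g then (q - 2) * q ^ (j - 1 - (j - a - s0) / 2)
      else 2 * (q - 1) * q ^ (j - 1 - (j - a - s0) / 2) : ℕ))
    (hC1M : ∀ j a, (levelSet ρ Θ α ϖE h' j a).ncard = (if j = 0 then (if a = 0 then 1 else 0) else if j < a then 0
      else if j - a + 1 = s0 then q ^ j else if j - a + 1 < s0 then (if a = 0 then q ^ j else 0) else if (j - a - s0) % 2 = 1 then 0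
      else if a = 0 then (if j - a - s0 + 2 ≤ 2 * g then q ^ (j - (j - a - s0) / 2) else 0)
      else if j - a - s0 + 2 < 2 * g then (q - 1) * q ^ (j - 1 - (j - a - s0) / 2) else if j - a - s0 + 2 = 2 * g then q ^ (j - (j - a - s0) / 2) else 0 : ℕ))
    (hC2GEN : ∀ j a, j ≤ jl → a ≤ j → (a ≤ m ∧ (j + a ≤ m ∨ (2 * a ≤ m ∧ j + a ≤ jl))) →
      levelSetDep ρ Θ α ϖE h j a μ = levelSet ρ Θ α ϖE h j a ∧ levelSetDep ρ Θ α ϖE h' j a μ = levelSet ρ Θ α ϖE h' j a)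
    (hC2OFF : ∀ j a, j ≤ jl → a ≤ j → ¬ (a ≤ m ∧ (j + a ≤ m ∨ (2 * a ≤ m ∧ j + a ≤ jl))) → j + m ≠ jl + a →
      levelSetDep ρ Θ α ϖE h j a μ = ∅ ∧ levelSetDep ρ Θ α ϖE h' j a μ = ∅)
    (hC2TOPnear : ∀ j a, j ≤ jl → a ≤ j → ¬ (a ≤ m ∧ (j + a ≤ m ∨ (2 * a ≤ m ∧ j + a ≤ jl))) → j + m = jl + a → j + a + 2 ≤ m + s0 + 2 * g →
      (levelSetDep ρ Θ α ϖE h j a μ).ncard = (levelSetDep ρ Θ α ϖE h' j a μ).ncard)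
    (e : ℕ) (hed : e ≤ g + s0)
    (hC2TOPfarE : ∀ j a, j ≤ jl → a ≤ j → ¬ (a ≤ m ∧ (j + a ≤ m ∨ (2 * a ≤ m ∧ j + a ≤ jl))) → j + m = jl + a → ¬ (j + a + 2 ≤ m + s0 + 2 * g) →
      (((levelSetDep ρ Θ α ϖE h j a μ).ncard : ℚ) = if 2 * j + (g + s0) ≤ 2 * jl + 1 + e ∧ ε = 1 then 2 * (q : ℚ) ^ (j - (j + a - m - s0 + 1) / 2) else 0) ∧
      (((levelSetDep ρ Θ α ϖE h' j a μ).ncard : ℚ) = if 2 * j + (g + s0) ≤ 2 * jl + 1 + e ∧ ε = -1 then 2 * (q : ℚ) ^ (j - (j + a - m - s0 + 1) / 2) else 0))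
    (C : ℕ) (hC : jl ≤ C) (hCe : C + (g + s0) ≤ m + jl + 1) :
    ε * ∑ j ∈ range (jl + 1), ∑ a ∈ range (jl + 2), (q : ℚ) ^ a *
        (if j + a ≤ C then ((levelSetDep ρ Θ α ϖE h j a μ).ncard : ℚ) - ((levelSetDep ρ Θ α ϖE h' j a μ).ncard : ℚ) else 0) =
      (q : ℚ) ^ m * (2 * ∑ i ∈ range ((jl - g) / 2 + 1), (q : ℚ) ^ i - 2 * ∑ i ∈ range (g + s0 - (g + s0) % 2), (q : ℚ) ^ i) -
        2 * ∑ a ∈ (range (jl + 2)).filter (fun a => a ≤ m ∧ C + m < jl + 2 * a ∧ 2 * m + 2 * g + s0 < jl + 2 * a + 2 ∧ 2 * a + (g + s0) ≤ 2 * m + 1),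
          (q : ℚ) ^ (a + (jl + s0) / 2) := by
  classical
  -- cells `a > j` are empty on both scalars, with or without the depth condition (adapted from ★ `toricCensusSum_ramM_weld`, LH4-p04 (g5))
  have hEmp : ∀ (s : K), s ≠ 0 → ∀ j a, j < a → levelSet ρ Θ α ϖE s j a = ∅ := fun s hs j a hja =>
    levelSet_eq_empty_of_succ_le_ramified (Θ := Θ) hD hvΘ hρϖ hϖE hs (by omega)
  have hEmpD : ∀ (s : K), s ≠ 0 → ∀ j a, j < a → ∀ μ' : K, levelSetDep ρ Θ α ϖE s j a μ' = ∅ := fun s hs j a hja μ' =>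
    Set.subset_eq_empty (levelSetDep_subset ρ Θ α ϖE s j a μ') (hEmp s hs j a hja)
  -- the tables: the census itself (EDITION-2 binders ask the near top cells only to agree)
  obtain ⟨nP, hnPdef⟩ : ∃ f : ℕ → ℕ → ℚ, f = fun j a => ((levelSet ρ Θ α ϖE h j a).ncard : ℚ) := ⟨_, rfl⟩
  obtain ⟨nM, hnMdef⟩ : ∃ f : ℕ → ℕ → ℚ, f = fun j a => ((levelSet ρ Θ α ϖE h' j a).ncard : ℚ) := ⟨_, rfl⟩
  obtain ⟨vP, hvPdef⟩ : ∃ f : ℕ → ℕ → ℚ, f = fun j a => if j ≤ jl then ((levelSetDep ρ Θ α ϖE h j a μ).ncard : ℚ) else 0 := ⟨_, rfl⟩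
  obtain ⟨vM, hvMdef⟩ : ∃ f : ℕ → ℕ → ℚ, f = fun j a => if j ≤ jl then ((levelSetDep ρ Θ α ϖE h' j a μ).ncard : ℚ) else 0 := ⟨_, rfl⟩
  have hnP : ∀ j a, nP j a = ((if j = 0 then (if a = 0 then 1 else 0) else if j < a then 0
      else if j - a + 1 = s0 then q ^ j else if j - a + 1 < s0 then (if a = 0 then q ^ j else 0) else if (j - a - s0) % 2 = 1 then 0
      else if a = 0 then (if 2 * g ≤ j - a - s0 then 2 else 1) * q ^ (j - (j - a - s0) / 2)
      else if j - a - s0 + 2 < 2 * g then (q - 1) * q ^ (j - 1 - (j - a - s0) / 2) else if j - a - s0 + 2 = 2 * g then (q - 2) * q ^ (j - 1 - (j - a - s0) / 2)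
      else 2 * (q - 1) * q ^ (j - 1 - (j - a - s0) / 2) : ℕ) : ℚ) := fun j a => by
    rw [hnPdef]; dsimp only; rw [hC1P j a]
  have hnM : ∀ j a, nM j a = ((if j = 0 then (if a = 0 then 1 else 0) else if j < a then 0
      else if j - a + 1 = s0 then q ^ j else if j - a + 1 < s0 then (if a = 0 then q ^ j else 0) else if (j - a - s0) % 2 = 1 then 0
      else if a = 0 then (if j - a - s0 + 2 ≤ 2 * g then q ^ (j - (j - a - s0) / 2) else 0)
      else if j - a - s0 + 2 < 2 * g then (q - 1) * q ^ (j - 1 - (j - a - s0) / 2) else if j - a - s0 + 2 = 2 * g then q ^ (j - (j - a - s0) / 2) else 0 : ℕ) : ℚ) :=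
    fun j a => by rw [hnMdef]; dsimp only; rw [hC1M j a]
  have hvGen : ∀ j a, (a ≤ m ∧ (j + a ≤ m ∨ (2 * a ≤ m ∧ j + a ≤ jl))) → vP j a = nP j a ∧ vM j a = nM j a := by
    intro j a hG
    have hj : j ≤ jl := by omega
    rw [hvPdef, hvMdef, hnPdef, hnMdef]; dsimp only; rw [if_pos hj, if_pos hj]
    by_cases haj : a ≤ j
    · obtain ⟨h1, h2⟩ := hC2GEN j a hj haj hG
      rw [h1, h2]; exact ⟨rfl, rfl⟩
    · rw [hEmpD h hh j a (by omega), hEmpD h' hh' j a (by omega), hEmp h hh j a (by omega), hEmp h' hh' j a (by omega)]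
      exact ⟨rfl, rfl⟩
  have hvOff : ∀ j a, ¬ (a ≤ m ∧ (j + a ≤ m ∨ (2 * a ≤ m ∧ j + a ≤ jl))) → j + m ≠ jl + a → vP j a = 0 ∧ vM j a = 0 := by
    intro j a hnG hoff
    rw [hvPdef, hvMdef]; dsimp only
    by_cases hj : j ≤ jl
    · rw [if_pos hj, if_pos hj]
      by_cases haj : a ≤ j
      · obtain ⟨h1, h2⟩ := hC2OFF j a hj haj hnG hoff
        rw [h1, h2, Set.ncard_empty, Nat.cast_zero]; exact ⟨rfl, rfl⟩
      · rw [hEmpD h hh j a (by omega), hEmpD h' hh' j a (by omega), Set.ncard_empty, Nat.cast_zero]; exact ⟨rfl, rfl⟩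
    · rw [if_neg hj, if_neg hj]; exact ⟨rfl, rfl⟩
  have hvTopNear : ∀ j a, ¬ (a ≤ m ∧ (j + a ≤ m ∨ (2 * a ≤ m ∧ j + a ≤ jl))) → j + m = jl + a → j + a + 2 ≤ m + s0 + 2 * g → vP j a = vM j a := by
    intro j a hnG hdiag hnear
    rw [hvPdef, hvMdef]; dsimp only
    by_cases hj : j ≤ jl
    · rw [if_pos hj, if_pos hj, hC2TOPnear j a hj (by omega) hnG hdiag hnear]
    · rw [if_neg hj, if_neg hj]
  have hvTopFarE : ∀ j a, ¬ (a ≤ m ∧ (j + a ≤ m ∨ (2 * a ≤ m ∧ j + a ≤ jl))) → j + m = jl + a → ¬ (j + a + 2 ≤ m + s0 + 2 * g) →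
      (vP j a = if 2 * j + (g + s0) ≤ 2 * jl + 1 + e ∧ ε = 1 then 2 * (q : ℚ) ^ (j - (j + a - m - s0 + 1) / 2) else 0) ∧
      (vM j a = if 2 * j + (g + s0) ≤ 2 * jl + 1 + e ∧ ε = -1 then 2 * (q : ℚ) ^ (j - (j + a - m - s0 + 1) / 2) else 0) := by
    intro j a hnG hdiag hfar
    rw [hvPdef, hvMdef]; dsimp only
    by_cases hj : j ≤ jl
    · rw [if_pos hj, if_pos hj]
      exact hC2TOPfarE j a hj (by omega) hnG hdiag hfar
    · have hbit : ¬ (2 * j + (g + s0) ≤ 2 * jl + 1 + e ∧ ε = 1) := fun hc => by omega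
      have hbit' : ¬ (2 * j + (g + s0) ≤ 2 * jl + 1 + e ∧ ε = -1) := fun hc => by omega
      rw [if_neg hj, if_neg hj, if_neg hbit, if_neg hbit']; exact ⟨rfl, rfl⟩
  -- the ★ EDITION-2 cut identity, then unfold the tables on `j ≤ jl`
  have key := toricCensusSum_ramM_v2_cut_offset q ε hq hg hs0 hjl hjlS hparW hmS hm hε nP nM vP vM hnP hnM hvGen hvOff hvTopNear e hvTopFarE C hC hCe
  rw [← key]
  congr 1
  refine sum_congr rfl fun j hj => sum_congr rfl fun a _ => ?_
  have hj' : j ≤ jl := by rw [mem_range] at hj; omega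
  rw [hvPdef, hvMdef]; dsimp only; rw [if_pos hj', if_pos hj']

/-! ## §2 Flipped parity class, EDITION 2 -/

/-- **(T5-P-weldΔ)-RamM♭ EDITION 2, FLIPPED CLASS — THE CUT WELD modulo the per-cell facts, BOTH PARITY REGIMES.**  ★ p860627 `toricCensusSum_ramM_weld_cut_flip`'s binders
with `hparW : m % 2 = (g + s0 + 1) % 2 ∨ jl + 2 ≤ m + 2g + s0`; same conclusion; over `toricCensusSum_ramM_flip_v2_cut_offset`.
[cite: Kottwitz1986BaseChangeUnits, §1 pp. 240–241] [cite: Rogawski1990, §4.9 Prop. 4.9.1 (b) p. 55, Lemma 4.9.3 p. 56] [cite: Flicker1998UnitaryFL, Prop. 7 p. 84] [cite: Jacobowitz1962, §4] -/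
theorem toricCensusSum_ramM_weld_cut_flip_v2 (hD : IsRamifiedQuadraticDatum ρ α dρ t) (hvΘ : ∀ x, Valued.v (Θ x) = Valued.v x)
    (hρϖ : ρ ϖE = ϖE) (hϖE : Valued.v ϖE = exp (-2 : ℤ)) (hh : h ≠ 0) (hh' : h' ≠ 0)
    (q : ℕ) {g s0 jl m : ℕ} (ε : ℚ) (hq : 2 ≤ q) (hg : 1 ≤ g) (hs0 : 1 ≤ s0) (hjl : jl % 2 = (g + 1) % 2)
    (hjlS : 3 * g + 2 * s0 ≤ jl + 3) (hparW : m % 2 = (g + s0 + 1) % 2 ∨ jl + 2 ≤ m + 2 * g + s0)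
    (hmS : g + s0 ≤ m + 1) (hm : m ≤ jl) (hε : ε = 1 ∨ (ε = -1 ∧ jl + 2 ≤ m + 2 * g + s0)) {μ : K}
    (hC1P : ∀ j a, (levelSet ρ Θ α ϖE h j a).ncard = (if j = 0 then (if a = 0 then 1 else 0) else if j < a then 0
      else if j - a + 1 = s0 then q ^ j else if j - a + 1 < s0 then (if a = 0 then q ^ j else 0) else if (j - a - s0) % 2 = 1 then 0
      else if a = 0 then (if 2 * g ≤ j - a - s0 then 2 else 1) * q ^ (j - (j - a - s0) / 2)
      else if j - a - s0 + 2 < 2 * g then (q - 1) * q ^ (j - 1 - (j - a - s0) / 2) else if j - a - s0 + 2 = 2 * g then (q - 2) * q ^ (j - 1 - (j - a - s0) / 2)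
      else 2 * (q - 1) * q ^ (j - 1 - (j - a - s0) / 2) : ℕ))
    (hC1M : ∀ j a, (levelSet ρ Θ α ϖE h' j a).ncard = (if j = 0 then (if a = 0 then 1 else 0) else if j < a then 0
      else if j - a + 1 = s0 then q ^ j else if j - a + 1 < s0 then (if a = 0 then q ^ j else 0) else if (j - a - s0) % 2 = 1 then 0
      else if a = 0 then (if j - a - s0 + 2 ≤ 2 * g then q ^ (j - (j - a - s0) / 2) else 0)
      else if j - a - s0 + 2 < 2 * g then (q - 1) * q ^ (j - 1 - (j - a - s0) / 2) else if j - a - s0 + 2 = 2 * g then q ^ (j - (j - a - s0) / 2) else 0 : ℕ))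
    (hC2GEN : ∀ j a, j ≤ jl → a ≤ j → (a ≤ m ∧ (j + a ≤ m ∨ (2 * a ≤ m ∧ j + a ≤ jl))) →
      levelSetDep ρ Θ α ϖE h j a μ = levelSet ρ Θ α ϖE h j a ∧ levelSetDep ρ Θ α ϖE h' j a μ = levelSet ρ Θ α ϖE h' j a)
    (hC2OFF : ∀ j a, j ≤ jl → a ≤ j → ¬ (a ≤ m ∧ (j + a ≤ m ∨ (2 * a ≤ m ∧ j + a ≤ jl))) → j + m ≠ jl + a →
      levelSetDep ρ Θ α ϖE h j a μ = ∅ ∧ levelSetDep ρ Θ α ϖE h' j a μ = ∅)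
    (hC2TOPnear : ∀ j a, j ≤ jl → a ≤ j → ¬ (a ≤ m ∧ (j + a ≤ m ∨ (2 * a ≤ m ∧ j + a ≤ jl))) → j + m = jl + a → j + a + 2 ≤ m + s0 + 2 * g →
      (levelSetDep ρ Θ α ϖE h j a μ).ncard = (levelSetDep ρ Θ α ϖE h' j a μ).ncard)
    (e : ℕ) (hed : e ≤ g + s0)
    (hC2TOPfarE : ∀ j a, j ≤ jl → a ≤ j → ¬ (a ≤ m ∧ (j + a ≤ m ∨ (2 * a ≤ m ∧ j + a ≤ jl))) → j + m = jl + a → ¬ (j + a + 2 ≤ m + s0 + 2 * g) →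
      (((levelSetDep ρ Θ α ϖE h j a μ).ncard : ℚ) = if 2 * j + (g + s0) ≤ 2 * jl + 1 + e ∧ ε = 1 then 2 * (q : ℚ) ^ (j - (j + a - m - s0 + 1) / 2) else 0) ∧
      (((levelSetDep ρ Θ α ϖE h' j a μ).ncard : ℚ) = if 2 * j + (g + s0) ≤ 2 * jl + 1 + e ∧ ε = -1 then 2 * (q : ℚ) ^ (j - (j + a - m - s0 + 1) / 2) else 0))
    (C : ℕ) (hC : jl ≤ C) (hCe : C + (g + s0) ≤ m + jl + 1) :
    ε * ∑ j ∈ range (jl + 1), ∑ a ∈ range (jl + 2), (q : ℚ) ^ a *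
        (if j + a ≤ C then ((levelSetDep ρ Θ α ϖE h j a μ).ncard : ℚ) - ((levelSetDep ρ Θ α ϖE h' j a μ).ncard : ℚ) else 0) =
      (q : ℚ) ^ m * (2 * ∑ i ∈ range ((jl + 1 - g) / 2 + (g + s0) % 2), (q : ℚ) ^ i - 2 * ∑ i ∈ range (g + s0 - 1 + (g + s0) % 2), (q : ℚ) ^ i) -
        2 * ∑ a ∈ (range (jl + 2)).filter (fun a => a ≤ m ∧ C + m < jl + 2 * a ∧ 2 * m + 2 * g + s0 < jl + 2 * a + 2 ∧ 2 * a + (g + s0) ≤ 2 * m + 1),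
          (q : ℚ) ^ (a + (jl + s0) / 2) := by
  classical
  -- as §1, with the flipped ★ EDITION-2 cut identity
  have hEmp : ∀ (s : K), s ≠ 0 → ∀ j a, j < a → levelSet ρ Θ α ϖE s j a = ∅ := fun s hs j a hja =>
    levelSet_eq_empty_of_succ_le_ramified (Θ := Θ) hD hvΘ hρϖ hϖE hs (by omega)
  have hEmpD : ∀ (s : K), s ≠ 0 → ∀ j a, j < a → ∀ μ' : K, levelSetDep ρ Θ α ϖE s j a μ' = ∅ := fun s hs j a hja μ' =>
    Set.subset_eq_empty (levelSetDep_subset ρ Θ α ϖE s j a μ') (hEmp s hs j a hja)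
  -- the tables: the census itself (EDITION-2 binders ask the near top cells only to agree)
  obtain ⟨nP, hnPdef⟩ : ∃ f : ℕ → ℕ → ℚ, f = fun j a => ((levelSet ρ Θ α ϖE h j a).ncard : ℚ) := ⟨_, rfl⟩
  obtain ⟨nM, hnMdef⟩ : ∃ f : ℕ → ℕ → ℚ, f = fun j a => ((levelSet ρ Θ α ϖE h' j a).ncard : ℚ) := ⟨_, rfl⟩
  obtain ⟨vP, hvPdef⟩ : ∃ f : ℕ → ℕ → ℚ, f = fun j a => if j ≤ jl then ((levelSetDep ρ Θ α ϖE h j a μ).ncard : ℚ) else 0 := ⟨_, rfl⟩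
  obtain ⟨vM, hvMdef⟩ : ∃ f : ℕ → ℕ → ℚ, f = fun j a => if j ≤ jl then ((levelSetDep ρ Θ α ϖE h' j a μ).ncard : ℚ) else 0 := ⟨_, rfl⟩
  have hnP : ∀ j a, nP j a = ((if j = 0 then (if a = 0 then 1 else 0) else if j < a then 0
      else if j - a + 1 = s0 then q ^ j else if j - a + 1 < s0 then (if a = 0 then q ^ j else 0) else if (j - a - s0) % 2 = 1 then 0
      else if a = 0 then (if 2 * g ≤ j - a - s0 then 2 else 1) * q ^ (j - (j - a - s0) / 2)
      else if j - a - s0 + 2 < 2 * g then (q - 1) * q ^ (j - 1 - (j - a - s0) / 2) else if j - a - s0 + 2 = 2 * g then (q - 2) * q ^ (j - 1 - (j - a - s0) / 2)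
      else 2 * (q - 1) * q ^ (j - 1 - (j - a - s0) / 2) : ℕ) : ℚ) := fun j a => by
    rw [hnPdef]; dsimp only; rw [hC1P j a]
  have hnM : ∀ j a, nM j a = ((if j = 0 then (if a = 0 then 1 else 0) else if j < a then 0
      else if j - a + 1 = s0 then q ^ j else if j - a + 1 < s0 then (if a = 0 then q ^ j else 0) else if (j - a - s0) % 2 = 1 then 0
      else if a = 0 then (if j - a - s0 + 2 ≤ 2 * g then q ^ (j - (j - a - s0) / 2) else 0)
      else if j - a - s0 + 2 < 2 * g then (q - 1) * q ^ (j - 1 - (j - a - s0) / 2) else if j - a - s0 + 2 = 2 * g then q ^ (j - (j - a - s0) / 2) else 0 : ℕ) : ℚ) :=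
    fun j a => by rw [hnMdef]; dsimp only; rw [hC1M j a]
  have hvGen : ∀ j a, (a ≤ m ∧ (j + a ≤ m ∨ (2 * a ≤ m ∧ j + a ≤ jl))) → vP j a = nP j a ∧ vM j a = nM j a := by
    intro j a hG
    have hj : j ≤ jl := by omega
    rw [hvPdef, hvMdef, hnPdef, hnMdef]; dsimp only; rw [if_pos hj, if_pos hj]
    by_cases haj : a ≤ j
    · obtain ⟨h1, h2⟩ := hC2GEN j a hj haj hG
      rw [h1, h2]; exact ⟨rfl, rfl⟩
    · rw [hEmpD h hh j a (by omega), hEmpD h' hh' j a (by omega), hEmp h hh j a (by omega), hEmp h' hh' j a (by omega)]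
      exact ⟨rfl, rfl⟩
  have hvOff : ∀ j a, ¬ (a ≤ m ∧ (j + a ≤ m ∨ (2 * a ≤ m ∧ j + a ≤ jl))) → j + m ≠ jl + a → vP j a = 0 ∧ vM j a = 0 := by
    intro j a hnG hoff
    rw [hvPdef, hvMdef]; dsimp only
    by_cases hj : j ≤ jl
    · rw [if_pos hj, if_pos hj]
      by_cases haj : a ≤ j
      · obtain ⟨h1, h2⟩ := hC2OFF j a hj haj hnG hoff
        rw [h1, h2, Set.ncard_empty, Nat.cast_zero]; exact ⟨rfl, rfl⟩
      · rw [hEmpD h hh j a (by omega), hEmpD h' hh' j a (by omega), Set.ncard_empty, Nat.cast_zero]; exact ⟨rfl, rfl⟩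
    · rw [if_neg hj, if_neg hj]; exact ⟨rfl, rfl⟩
  have hvTopNear : ∀ j a, ¬ (a ≤ m ∧ (j + a ≤ m ∨ (2 * a ≤ m ∧ j + a ≤ jl))) → j + m = jl + a → j + a + 2 ≤ m + s0 + 2 * g → vP j a = vM j a := by
    intro j a hnG hdiag hnear
    rw [hvPdef, hvMdef]; dsimp only
    by_cases hj : j ≤ jl
    · rw [if_pos hj, if_pos hj, hC2TOPnear j a hj (by omega) hnG hdiag hnear]
    · rw [if_neg hj, if_neg hj]
  have hvTopFarE : ∀ j a, ¬ (a ≤ m ∧ (j + a ≤ m ∨ (2 * a ≤ m ∧ j + a ≤ jl))) → j + m = jl + a → ¬ (j + a + 2 ≤ m + s0 + 2 * g) →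
      (vP j a = if 2 * j + (g + s0) ≤ 2 * jl + 1 + e ∧ ε = 1 then 2 * (q : ℚ) ^ (j - (j + a - m - s0 + 1) / 2) else 0) ∧
      (vM j a = if 2 * j + (g + s0) ≤ 2 * jl + 1 + e ∧ ε = -1 then 2 * (q : ℚ) ^ (j - (j + a - m - s0 + 1) / 2) else 0) := by
    intro j a hnG hdiag hfar
    rw [hvPdef, hvMdef]; dsimp only
    by_cases hj : j ≤ jl
    · rw [if_pos hj, if_pos hj]
      exact hC2TOPfarE j a hj (by omega) hnG hdiag hfar
    · have hbit : ¬ (2 * j + (g + s0) ≤ 2 * jl + 1 + e ∧ ε = 1) := fun hc => by omega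
      have hbit' : ¬ (2 * j + (g + s0) ≤ 2 * jl + 1 + e ∧ ε = -1) := fun hc => by omega
      rw [if_neg hj, if_neg hj, if_neg hbit, if_neg hbit']; exact ⟨rfl, rfl⟩
  -- the ★ EDITION-2 cut identity, then unfold the tables on `j ≤ jl`
  have key := toricCensusSum_ramM_flip_v2_cut_offset q ε hq hg hs0 hjl hjlS hparW hmS hm hε nP nM vP vM hnP hnM hvGen hvOff hvTopNear e hvTopFarE C hC hCe
  rw [← key]
  congr 1
  refine sum_congr rfl fun j hj => sum_congr rfl fun a _ => ?_
  have hj' : j ≤ jl := by rw [mem_range] at hj; omega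
  rw [hvPdef, hvMdef]; dsimp only; rw [if_pos hj', if_pos hj']

end Summit.HodgeConjecture.HodgeConjecture.Cruxes.H413.F0P3cDyRamToricCensusSumRamMWeldCutV2
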